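import Summits.Ventures.YMGap.RobustBall.MassGapOnBallZdGRowsSU3Certified
import Summits.Ventures.YMGap.Thresholds.OneLinkVarianceSD
import HarnessLib

/-!
# Venture YMGap, track ROBUST-BALL (Y2) — `SU(3)` HYPOTHESIS-FREE star rows on the Poincaré × Schwinger–Dyson modulus:
# schemas (torus `d = 4` / `d = 3` / reads-incidence / `ℤ⁴` / `ℤ³`) and the `d = 4` torus cells

HONEST FRAMING. WHAT THIS IS: a venture file (cell `pub-ymgap`, track Y2 ROBUST-BALL, seat engine-2 (g9); 0 compute).  Explicit
STRONG-COUPLING constants for lattice `SU(3)` Yang–Mills (small `β`), HYPOTHESIS-FREE (class K outright): ds-2's robust vertex-star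
doors (`RobustStarDoor`, `RobustStarDoorFine`, `RobustStarDoorZd`; generic any-modulus schemas of `TorusRowsSU3StarCertified` /
`MassGapOnBallZdGRowsSU3Certified`) fed with the tree's NEW hypothesis-free one-link modulus
`OneLinkVarianceSD.oneLinkKRModulus_pv`: `K_PV(3,R) = (3R/2 + √(1 + 9R²/4))/√(1/2 − R)` (Bakry–Émery Poincaré for the test function ×
p2's Schwinger–Dyson second moment for the linear observable, through pub-balaban's Poincaré–variance door), in place of p2's first-order
eigen modulus `K₁(3,R) = (9/8)(1/2 + 2R)/(1/2 − R)` used by ds-2's hypothesis-free `SU(3)` cells (`TorusRowsSU3Star`,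
`MassGapOnBallZdGRowsSUN`) — `K_PV < K₁` for `R > 0.07`, e.g. `R = 1/6`: `2.218` vs `2.8125`.
* §1 `SU(3)` PV SCHEMAS (rational envelope `q² ≥ 1 + 9R²/4`, `p²(1/2 − R) ≥ 1`, `K ≥ (3R/2 + q)p` at the star radius `R ≥ 6β_W/9`
  resp. `4β_W/9`; then ds-2's three door inequalities verbatim): `su3_torusClusteringOnBallUpTo_pvStar` (`d = 4`),
  `su3_clusterDomainClustering_dim3_pvStar` (`d = 3`, Y4's receiving currency + torus form), `su3_torusClusteringOnBallFine_pvStar`,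
  `su3_massGapOnBallZdG_pvStar` (`ℤ⁴`), `su3_massGapOnBallZdG_dim3_pvStar` (`ℤ³`);
* §2 the `d = 4` CELLS `(β_W, ε)` (one-parameter ball `(ε₀, ε₁) = (2ε, ε)`, exact rationals, `e^{2ε}` by `Real.exp_bound'` (five terms,
  inlined), `√3 ≤ 1.73206`, Neumann depth 20; certificates by exact `Fraction` arithmetic, engine-2 `work/cert_pv.py`):
  torus `∃ A m, 0 < m ∧ TorusClusteringOnBallUpTo 3 4 (β_W/3) (2ε) ε r A m` (the `ℤ⁴`/`ℤ³` cells with the SAME certificates are the sibling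
  `MassGapOnBallZdGRowsSU3PV.lean`, the `d = 3` torus cells `StarRowsSU3PVDim3.lean`):
  (1 / 8, .150) (1 / 6, .114) (1 / 5, .087) (1 / 4, .049) (27 / 100, .034) (3 / 10, .013) (31 / 100, .005)
  reads-incidence (fine) ball at `β_W = 1/4`: (1 / 4, .049).
WHAT MOVES (cell bookkeeping, ROBUST-BALL-STATEMENT rows 1i/2g `SU(3)` hyp-free): ds-2's hypothesis-free `SU(3)` `d = 4` / `ℤ⁴` star cells
were (1/8, .148) (1/6, .104) (1/5, .069) (1/4, .019) (frontier `β_W = 1/4`); every cell here is larger and the frontier moves to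
`β_W = 0.31` (door threshold at `ε → 0`: `0.318`; with `K₁`: `0.27`).  The CERTIFIED cells (GIVEN H1, H2, `K = 7/5`) of
`TorusRowsSU3StarCertifiedDim4` / `MassGapOnBallZdGRowsSU3Certified` ((1/4, .103) … (11/20, .007)) are untouched and remain larger from
`β_W = 1/4` on: these rows say what the certificates buy above the new class-K baseline.
WHAT THIS IS NOT: radii / thresholds are door artefacts, not phase boundaries; one-sided clustering bounds (torus) resp. DLR uniqueness
+ clustering (`ℤ⁴`), not a transfer-matrix spectral gap; nothing at weak coupling, nothing about the continuum limit or the Millennium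
problem; nothing about `SU(2)` (quarter modulus) or `N ≥ 4`.

## References
* H. Shen, R. Zhu, X. Zhu, CMP 400 (2023), arXiv:2204.12737, Lemma 4.1 / Rem. 1.3 (Bakry–Émery on `SU(N)`).
* R. L. Dobrushin, S. B. Shlosman (1985); H. Föllmer, LNM 1362 (1988) Thm. (2.13) (covariance estimate behind `√(c·v)`).
* The tree: `Thresholds/OneLinkVarianceSD.lean` (engine-2 g9: the PV modulus), `RobustBall/TorusRowsSU3StarCertified.lean`,
  `MassGapOnBallZdGRowsSU3Certified.lean` (engine-2 g8: any-modulus schemas), `RobustStarDoor*.lean` (ds-2), `Thresholds/StarResolventDim.lean`.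
-/

noncomputable section

open Finset
open Literature.MathematicalPhysics.QuantumLattice (fundamentalRep)
open Literature.MathematicalPhysics.QuantumFieldTheory hiding ZdEdge
open Literature.MathematicalPhysics.QuantumFieldTheory.Balaban1983to89.StrongCouplingTorusWindow
open Literature.MathematicalPhysics.QuantumFieldTheory.Balaban1983to89.StrongCouplingDobrushinWindow
  (OneLinkKRModulus)
open Summit.Ventures.YMGap.StarResolventDim (Delta gaugeR doorPoly Delta_pos_of_door gaugeR_lt_one_of_door)
open Summit.Ventures.YMGap.OneLinkVarianceSD (su3_oneLinkKRModulus_pv_of_le)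

namespace Summit.Ventures.YMGap.RobustBall

/-! ### 1. The `SU(3)` PV-star schemas (hypothesis-free) -/

/-- Nonnegativity of the enveloped constant. [folklore] -/
theorem pvK_nonneg {R q p K : ℝ} (hR0 : 0 ≤ R) (hq0 : 0 ≤ q) (hp0 : 0 ≤ p) (hK : (3 * R / 2 + q) * p ≤ K) : 0 ≤ K :=
  le_trans (by positivity) hK

/-- **SCHEMA, `SU(3)`, `d = 4`, HYPOTHESIS-FREE (PV modulus)**: for `0 < β_W`, a radius `R ≥ 6β_W/9` with `R < 1/2`, an enveloped
PV constant `K ≥ (3R/2 + q)p` (`q² ≥ 1 + 9R²/4`, `p²(1/2 − R) ≥ 1`), a majorant `e^{ε₀} ≤ E`, a coefficient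
`c ≥ K·E·(1 + 2·1.73206·ε₁)·β_W/9`, `λ ≥ 1.73206·ε₁` and ds-2's three door inequalities, there are `A`, `m > 0` with
`TorusClusteringOnBallUpTo 3 4 (β_W/3) ε₀ ε₁ r A m`. [folklore] -/
theorem su3_torusClusteringOnBallUpTo_pvStar (Kn : ℕ) {βW ε₀ ε₁ c lam E R q p K : ℝ} (hβ0 : 0 < βW)
    (hR : βW / 9 * 6 ≤ R) (hR0 : 0 ≤ R) (hR2 : R < 1 / 2) (hq0 : 0 ≤ q) (hq : 1 + 9 * R ^ 2 / 4 ≤ q ^ 2) (hp0 : 0 ≤ p)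
    (hp : 1 ≤ p ^ 2 * (1 / 2 - R)) (hK : (3 * R / 2 + q) * p ≤ K)
    (hε₁ : 0 ≤ ε₁) (hE : Real.exp ε₀ ≤ E) (hc : K * E * (1 + 2 * 1.73206 * ε₁) * (βW / 9) ≤ c)
    (hlam : 1.73206 * ε₁ ≤ lam) (hθ1 : 6 * c + lam < 1) (hcd : doorPoly 4 c < 1)
    (hρ1 : gaugeR 4 c + (lam + (6 * c + lam) ^ Kn * (16 * lam)) / (1 - (6 * c + lam)) < 1) (r : ℕ) :
    ∃ A m : ℝ, 0 < m ∧ TorusClusteringOnBallUpTo 3 4 (βW / 3) ε₀ ε₁ r A m := by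
  have hS : Real.sqrt ((3 : ℕ) : ℝ) ≤ 1.73206 := by
    have : ((3 : ℕ) : ℝ) = 3 := by norm_num
    rw [this]; exact sqrt_three_le
  have e9 : βW / ((3 : ℕ) : ℝ) ^ 2 = βW / 9 := by norm_num
  have e3 : βW / ((3 : ℕ) : ℝ) = βW / 3 := by norm_num
  have hR' : βW / ((3 : ℕ) : ℝ) ^ 2 * 6 ≤ R := by rw [e9]; exact hR
  have hc' : K * E * (1 + 2 * 1.73206 * ε₁) * (βW / ((3 : ℕ) : ℝ) ^ 2) ≤ c := by rw [e9]; exact hc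
  have h := suN_torusClusteringOnBallUpTo_star_of_modulus Kn (N := 3) (by norm_num) (pvK_nonneg hR0 hq0 hp0 hK)
    (su3_oneLinkKRModulus_pv_of_le hR0 hR2 hq0 hq hp0 hp hK) hβ0 hR' hε₁ hE hS hc' hlam hθ1 hcd hρ1 r
  rw [e3] at h
  exact h

/-- **SCHEMA, `SU(3)`, `d = 3`, HYPOTHESIS-FREE (PV modulus)**: radius `R ≥ 4β_W/9`, door `8c² + 6c < 1`, `θ = 4c + λ`,
`gaugeR 3 c + (λ + θ^Kn·12λ)/(1−θ) < 1`: Y4's `YM3IR.ClusterDomainClustering` on `ClusterDomainFR ε₀ ε₁ r` up to tree coupling `β_W/3`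
at some rate `m > 0`, plus the torus form. [folklore] -/
theorem su3_clusterDomainClustering_dim3_pvStar (Kn : ℕ) {βW ε₀ ε₁ c lam E R q p K : ℝ} (hβ0 : 0 < βW)
    (hR : βW / 9 * 4 ≤ R) (hR0 : 0 ≤ R) (hR2 : R < 1 / 2) (hq0 : 0 ≤ q) (hq : 1 + 9 * R ^ 2 / 4 ≤ q ^ 2) (hp0 : 0 ≤ p)
    (hp : 1 ≤ p ^ 2 * (1 / 2 - R)) (hK : (3 * R / 2 + q) * p ≤ K)
    (hε₁ : 0 ≤ ε₁) (hE : Real.exp ε₀ ≤ E) (hc : K * E * (1 + 2 * 1.73206 * ε₁) * (βW / 9) ≤ c)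
    (hlam : 1.73206 * ε₁ ≤ lam) (hθ1 : 4 * c + lam < 1) (hcd : doorPoly 3 c < 1)
    (hρ1 : gaugeR 3 c + (lam + (4 * c + lam) ^ Kn * (12 * lam)) / (1 - (4 * c + lam)) < 1) (r : ℕ) :
    ∃ m : ℝ, 0 < m ∧
      YM3IR.ClusterDomainClustering (G := SUN 3)
        ⟨fundamentalRep (Fin 3), βW / 3, fun _ _ W => W ∈ ClusterDomainFR ε₀ ε₁ r⟩ suFrobDist m ∧
      ∃ A : ℝ, TorusClusteringOnBallUpTo 3 3 (βW / 3) ε₀ ε₁ r A m := by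
  have hS : Real.sqrt ((3 : ℕ) : ℝ) ≤ 1.73206 := by
    have : ((3 : ℕ) : ℝ) = 3 := by norm_num
    rw [this]; exact sqrt_three_le
  have e9 : βW / ((3 : ℕ) : ℝ) ^ 2 = βW / 9 := by norm_num
  have e3 : βW / ((3 : ℕ) : ℝ) = βW / 3 := by norm_num
  have hR' : βW / ((3 : ℕ) : ℝ) ^ 2 * 4 ≤ R := by rw [e9]; exact hR
  have hc' : K * E * (1 + 2 * 1.73206 * ε₁) * (βW / ((3 : ℕ) : ℝ) ^ 2) ≤ c := by rw [e9]; exact hc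
  have h := suN_clusterDomainClustering_dim3_star_of_modulus Kn (N := 3) (by norm_num) (pvK_nonneg hR0 hq0 hp0 hK)
    (su3_oneLinkKRModulus_pv_of_le hR0 hR2 hq0 hq hp0 hp hK) hβ0 hR' hε₁ hE hS hc' hlam hθ1 hcd hρ1 r
  rw [e3] at h
  exact h

/-- **SCHEMA, `SU(3)`, `d = 4`, HYPOTHESIS-FREE (PV modulus), READS-INCIDENCE ball**: same hypotheses as
`su3_torusClusteringOnBallUpTo_pvStar`, conclusion `∃ A, ∃ m > 0, TorusClusteringOnBallFine 3 4 (β_W/3) ε₀ ε₁ r A m`. [folklore] -/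
theorem su3_torusClusteringOnBallFine_pvStar (Kn : ℕ) {βW ε₀ ε₁ c lam E R q p K : ℝ} (hβ0 : 0 < βW)
    (hR : βW / 9 * 6 ≤ R) (hR0 : 0 ≤ R) (hR2 : R < 1 / 2) (hq0 : 0 ≤ q) (hq : 1 + 9 * R ^ 2 / 4 ≤ q ^ 2) (hp0 : 0 ≤ p)
    (hp : 1 ≤ p ^ 2 * (1 / 2 - R)) (hK : (3 * R / 2 + q) * p ≤ K)
    (hε₁ : 0 ≤ ε₁) (hE : Real.exp ε₀ ≤ E) (hc : K * E * (1 + 2 * 1.73206 * ε₁) * (βW / 9) ≤ c)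
    (hlam : 1.73206 * ε₁ ≤ lam) (hθ1 : 6 * c + lam < 1) (hcd : doorPoly 4 c < 1)
    (hρ1 : gaugeR 4 c + (lam + (6 * c + lam) ^ Kn * (16 * lam)) / (1 - (6 * c + lam)) < 1) (r : ℕ) :
    ∃ A m : ℝ, 0 < m ∧ TorusClusteringOnBallFine 3 4 (βW / 3) ε₀ ε₁ r A m := by
  have hS : Real.sqrt ((3 : ℕ) : ℝ) ≤ 1.73206 := by
    have : ((3 : ℕ) : ℝ) = 3 := by norm_num
    rw [this]; exact sqrt_three_le
  have e9 : βW / ((3 : ℕ) : ℝ) ^ 2 = βW / 9 := by norm_num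
  have e3 : βW / ((3 : ℕ) : ℝ) = βW / 3 := by norm_num
  have hR' : βW / ((3 : ℕ) : ℝ) ^ 2 * 6 ≤ R := by rw [e9]; exact hR
  have hc' : K * E * (1 + 2 * 1.73206 * ε₁) * (βW / ((3 : ℕ) : ℝ) ^ 2) ≤ c := by rw [e9]; exact hc
  have h := suN_torusClusteringOnBallFine_star_of_modulus Kn (N := 3) (by norm_num) (pvK_nonneg hR0 hq0 hp0 hK)
    (su3_oneLinkKRModulus_pv_of_le hR0 hR2 hq0 hq hp0 hp hK) hβ0 hR' hε₁ hE hS hc' hlam hθ1 hcd hρ1 r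
  rw [e3] at h
  exact h

/-- **SCHEMA, `SU(3)`, `ℤ⁴`, HYPOTHESIS-FREE (PV modulus)**: same door hypotheses as the `d = 4` torus schema (`0 ≤ β_W`), conclusion
`MassGapOnBallZdG 4 3 (β_W/9) ε₀ ε₁ R` — for EVERY member of the gauge-invariant tier-1 `ℤ⁴` ball exactly one DLR state, exponentially
clustering (ds-2's `RobustStarDoorZd`). [folklore] -/
theorem su3_massGapOnBallZdG_pvStar (Kn : ℕ) {βW ε₀ ε₁ c lam E Rm q p K : ℝ} (hβ0 : 0 ≤ βW)
    (hR : βW / 9 * 6 ≤ Rm) (hR0 : 0 ≤ Rm) (hR2 : Rm < 1 / 2) (hq0 : 0 ≤ q) (hq : 1 + 9 * Rm ^ 2 / 4 ≤ q ^ 2) (hp0 : 0 ≤ p)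
    (hp : 1 ≤ p ^ 2 * (1 / 2 - Rm)) (hK : (3 * Rm / 2 + q) * p ≤ K)
    (hε₁ : 0 ≤ ε₁) (hE : Real.exp ε₀ ≤ E) (hc : K * E * (1 + 2 * 1.73206 * ε₁) * (βW / 9) ≤ c)
    (hlam : 1.73206 * ε₁ ≤ lam) (hθ1 : 6 * c + lam < 1) (hcd : doorPoly 4 c < 1)
    (hρ1 : gaugeR 4 c + (lam + (6 * c + lam) ^ Kn * (16 * lam)) / (1 - (6 * c + lam)) < 1) (R : ℕ) :
    MassGapOnBallZdG 4 3 (βW / 9) ε₀ ε₁ R := by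
  have hS : Real.sqrt ((3 : ℕ) : ℝ) ≤ 1.73206 := by
    have : ((3 : ℕ) : ℝ) = 3 := by norm_num
    rw [this]; exact sqrt_three_le
  have e9 : βW / ((3 : ℕ) : ℝ) ^ 2 = βW / 9 := by norm_num
  have hR' : βW / ((3 : ℕ) : ℝ) ^ 2 * 6 ≤ Rm := by rw [e9]; exact hR
  have hc' : K * E * (1 + 2 * 1.73206 * ε₁) * (βW / ((3 : ℕ) : ℝ) ^ 2) ≤ c := by rw [e9]; exact hc
  have h := suN_massGapOnBallZdG_star_of_modulus Kn (N := 3) (by norm_num) (pvK_nonneg hR0 hq0 hp0 hK)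
    (su3_oneLinkKRModulus_pv_of_le hR0 hR2 hq0 hq hp0 hp hK) hβ0 hR' hε₁ hE hS hc' hlam hθ1 hcd hρ1 R
  rw [e9] at h
  exact h

/-- **SCHEMA, `SU(3)`, `ℤ³`, HYPOTHESIS-FREE (PV modulus)**: radius `Rm ≥ 4β_W/9`, `d = 3` door, conclusion
`MassGapOnBallZdG 3 3 (β_W/9) ε₀ ε₁ R`. [folklore] -/
theorem su3_massGapOnBallZdG_dim3_pvStar (Kn : ℕ) {βW ε₀ ε₁ c lam E Rm q p K : ℝ} (hβ0 : 0 ≤ βW)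
    (hR : βW / 9 * 4 ≤ Rm) (hR0 : 0 ≤ Rm) (hR2 : Rm < 1 / 2) (hq0 : 0 ≤ q) (hq : 1 + 9 * Rm ^ 2 / 4 ≤ q ^ 2) (hp0 : 0 ≤ p)
    (hp : 1 ≤ p ^ 2 * (1 / 2 - Rm)) (hK : (3 * Rm / 2 + q) * p ≤ K)
    (hε₁ : 0 ≤ ε₁) (hE : Real.exp ε₀ ≤ E) (hc : K * E * (1 + 2 * 1.73206 * ε₁) * (βW / 9) ≤ c)
    (hlam : 1.73206 * ε₁ ≤ lam) (hθ1 : 4 * c + lam < 1) (hcd : doorPoly 3 c < 1)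
    (hρ1 : gaugeR 3 c + (lam + (4 * c + lam) ^ Kn * (12 * lam)) / (1 - (4 * c + lam)) < 1) (R : ℕ) :
    MassGapOnBallZdG 3 3 (βW / 9) ε₀ ε₁ R := by
  have hS : Real.sqrt ((3 : ℕ) : ℝ) ≤ 1.73206 := by
    have : ((3 : ℕ) : ℝ) = 3 := by norm_num
    rw [this]; exact sqrt_three_le
  have e9 : βW / ((3 : ℕ) : ℝ) ^ 2 = βW / 9 := by norm_num
  have hR' : βW / ((3 : ℕ) : ℝ) ^ 2 * 4 ≤ Rm := by rw [e9]; exact hR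
  have hc' : K * E * (1 + 2 * 1.73206 * ε₁) * (βW / ((3 : ℕ) : ℝ) ^ 2) ≤ c := by rw [e9]; exact hc
  have h := suN_massGapOnBallZdG_dim3_star_of_modulus Kn (N := 3) (by norm_num) (pvK_nonneg hR0 hq0 hp0 hK)
    (su3_oneLinkKRModulus_pv_of_le hR0 hR2 hq0 hq hp0 hp hK) hβ0 hR' hε₁ hE hS hc' hlam hθ1 hcd hρ1 R
  rw [e9] at h
  exact h

/-! ### 2. The `d = 4` torus cells and the reads-incidence cell -/

/-- `SU(3)`, `d = 4`, HYPOTHESIS-FREE: row `(1 / 8, .150)` — torus clustering on the whole tier-1 ball for every `0 ≤ β ≤ 1 / 24`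
(PV modulus at radius `1 / 12`, `K = 175491 / 100000`; certificate `c = 24999 / 500000`, `λ = 259809 / 1000000`, `E = 674931 / 500000`). [folklore] -/
theorem su3_torusClusteringOnBallUpTo_pvStar_oneEighth (r : ℕ) :
    ∃ A m : ℝ, 0 < m ∧ TorusClusteringOnBallUpTo 3 4 (1 / 24) (3 / 10) (3 / 20) r A m := by
  have e1 : (1 / 8 : ℝ) / 3 = 1 / 24 := by norm_num
  have h := su3_torusClusteringOnBallUpTo_pvStar 20 (βW := 1 / 8) (ε₀ := 3 / 10) (ε₁ := 3 / 20)
    (c := 24999 / 500000) (lam := 259809 / 1000000) (E := 674931 / 500000) (R := 1 / 12) (q := 1007783 / 1000000)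
    (p := 774597 / 500000) (K := 175491 / 100000) (by norm_num) (by norm_num) (by norm_num) (by norm_num) (by norm_num) (by norm_num)
    (by norm_num) (by norm_num) (by norm_num) (by norm_num)
    (by refine (Real.exp_bound' (x := 3 / 10) (by norm_num) (by norm_num) (n := 5) (by norm_num)).trans ?_; simp only [Finset.sum_range_succ, Finset.sum_range_zero, Nat.factorial]; norm_num)
    (by norm_num) (by norm_num) (by norm_num) (by unfold doorPoly; norm_num) (by unfold gaugeR Delta; norm_num) r
  rw [e1] at h
  exact h

/-- `SU(3)`, `d = 4`, HYPOTHESIS-FREE: row `(1 / 6, .114)` — torus clustering on the whole tier-1 ball for every `0 ≤ β ≤ 1 / 18`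
(PV modulus at radius `1 / 9`, `K = 37859 / 20000`; certificate `c = 61421 / 1000000`, `λ = 39491 / 200000`, `E = 1256087 / 1000000`). [folklore] -/
theorem su3_torusClusteringOnBallUpTo_pvStar_oneSixth (r : ℕ) :
    ∃ A m : ℝ, 0 < m ∧ TorusClusteringOnBallUpTo 3 4 (1 / 18) (57 / 250) (57 / 500) r A m := by
  have e1 : (1 / 6 : ℝ) / 3 = 1 / 18 := by norm_num
  have h := su3_torusClusteringOnBallUpTo_pvStar 20 (βW := 1 / 6) (ε₀ := 57 / 250) (ε₁ := 57 / 500)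
    (c := 61421 / 1000000) (lam := 39491 / 200000) (E := 1256087 / 1000000) (R := 1 / 9) (q := 506897 / 500000)
    (p := 100223 / 62500) (K := 37859 / 20000) (by norm_num) (by norm_num) (by norm_num) (by norm_num) (by norm_num) (by norm_num)
    (by norm_num) (by norm_num) (by norm_num) (by norm_num)
    (by refine (Real.exp_bound' (x := 57 / 250) (by norm_num) (by norm_num) (n := 5) (by norm_num)).trans ?_; simp only [Finset.sum_range_succ, Finset.sum_range_zero, Nat.factorial]; norm_num)
    (by norm_num) (by norm_num) (by norm_num) (by unfold doorPoly; norm_num) (by unfold gaugeR Delta; norm_num) r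
  rw [e1] at h
  exact h

/-- `SU(3)`, `d = 4`, HYPOTHESIS-FREE: row `(1 / 5, .087)` — torus clustering on the whole tier-1 ball for every `0 ≤ β ≤ 1 / 15`
(PV modulus at radius `2 / 15`, `K = 40289 / 20000`; certificate `c = 6933 / 100000`, `λ = 15069 / 100000`, `E = 148757 / 125000`). [folklore] -/
theorem su3_torusClusteringOnBallUpTo_pvStar_oneFifth (r : ℕ) :
    ∃ A m : ℝ, 0 < m ∧ TorusClusteringOnBallUpTo 3 4 (1 / 15) (87 / 500) (87 / 1000) r A m := by
  have e1 : (1 / 5 : ℝ) / 3 = 1 / 15 := by norm_num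
  have h := su3_torusClusteringOnBallUpTo_pvStar 20 (βW := 1 / 5) (ε₀ := 87 / 500) (ε₁ := 87 / 1000)
    (c := 6933 / 100000) (lam := 15069 / 100000) (E := 148757 / 125000) (R := 2 / 15) (q := 254951 / 250000)
    (p := 825723 / 500000) (K := 40289 / 20000) (by norm_num) (by norm_num) (by norm_num) (by norm_num) (by norm_num) (by norm_num)
    (by norm_num) (by norm_num) (by norm_num) (by norm_num)
    (by refine (Real.exp_bound' (x := 87 / 500) (by norm_num) (by norm_num) (n := 5) (by norm_num)).trans ?_; simp only [Finset.sum_range_succ, Finset.sum_range_zero, Nat.factorial]; norm_num)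
    (by norm_num) (by norm_num) (by norm_num) (by unfold doorPoly; norm_num) (by unfold gaugeR Delta; norm_num) r
  rw [e1] at h
  exact h

/-- `SU(3)`, `d = 4`, HYPOTHESIS-FREE: row `(1 / 4, .049)` — torus clustering on the whole tier-1 ball for every `0 ≤ β ≤ 1 / 12`
(PV modulus at radius `1 / 6`, `K = 110919 / 50000`; certificate `c = 4969 / 62500`, `λ = 84871 / 1000000`, `E = 1102963 / 1000000`). [folklore] -/
theorem su3_torusClusteringOnBallUpTo_pvStar_oneQuarter (r : ℕ) :
    ∃ A m : ℝ, 0 < m ∧ TorusClusteringOnBallUpTo 3 4 (1 / 12) (49 / 500) (49 / 1000) r A m := by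
  have e1 : (1 / 4 : ℝ) / 3 = 1 / 12 := by norm_num
  have h := su3_torusClusteringOnBallUpTo_pvStar 20 (βW := 1 / 4) (ε₀ := 49 / 500) (ε₁ := 49 / 1000)
    (c := 4969 / 62500) (lam := 84871 / 1000000) (E := 1102963 / 1000000) (R := 1 / 6) (q := 1030777 / 1000000)
    (p := 1732051 / 1000000) (K := 110919 / 50000) (by norm_num) (by norm_num) (by norm_num) (by norm_num) (by norm_num) (by norm_num)
    (by norm_num) (by norm_num) (by norm_num) (by norm_num)
    (by refine (Real.exp_bound' (x := 49 / 500) (by norm_num) (by norm_num) (n := 5) (by norm_num)).trans ?_; simp only [Finset.sum_range_succ, Finset.sum_range_zero, Nat.factorial]; norm_num)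
    (by norm_num) (by norm_num) (by norm_num) (by unfold doorPoly; norm_num) (by unfold gaugeR Delta; norm_num) r
  rw [e1] at h
  exact h

/-- `SU(3)`, `d = 4`, HYPOTHESIS-FREE: row `(27 / 100, .034)` — torus clustering on the whole tier-1 ball for every `0 ≤ β ≤ 9 / 100`
(PV modulus at radius `9 / 50`, `K = 230837 / 100000`; certificate `c = 16571 / 200000`, `λ = 58891 / 1000000`, `E = 535183 / 500000`). [folklore] -/
theorem su3_torusClusteringOnBallUpTo_pvStar_twentySevenHundredths (r : ℕ) :
    ∃ A m : ℝ, 0 < m ∧ TorusClusteringOnBallUpTo 3 4 (9 / 100) (17 / 250) (17 / 500) r A m := by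
  have e1 : (27 / 100 : ℝ) / 3 = 9 / 100 := by norm_num
  have h := su3_torusClusteringOnBallUpTo_pvStar 20 (βW := 27 / 100) (ε₀ := 17 / 250) (ε₁ := 17 / 500)
    (c := 16571 / 200000) (lam := 58891 / 1000000) (E := 535183 / 500000) (R := 9 / 50) (q := 1035809 / 1000000)
    (p := 1767767 / 1000000) (K := 230837 / 100000) (by norm_num) (by norm_num) (by norm_num) (by norm_num) (by norm_num) (by norm_num)
    (by norm_num) (by norm_num) (by norm_num) (by norm_num)
    (by refine (Real.exp_bound' (x := 17 / 250) (by norm_num) (by norm_num) (n := 5) (by norm_num)).trans ?_; simp only [Finset.sum_range_succ, Finset.sum_range_zero, Nat.factorial]; norm_num)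
    (by norm_num) (by norm_num) (by norm_num) (by unfold doorPoly; norm_num) (by unfold gaugeR Delta; norm_num) r
  rw [e1] at h
  exact h

/-- `SU(3)`, `d = 4`, HYPOTHESIS-FREE: row `(3 / 10, .013)` — torus clustering on the whole tier-1 ball for every `0 ≤ β ≤ 1 / 10`
(PV modulus at radius `1 / 5`, `K = 122693 / 50000`; certificate `c = 87731 / 1000000`, `λ = 22517 / 1000000`, `E = 1026341 / 1000000`). [folklore] -/
theorem su3_torusClusteringOnBallUpTo_pvStar_threeTenths (r : ℕ) :
    ∃ A m : ℝ, 0 < m ∧ TorusClusteringOnBallUpTo 3 4 (1 / 10) (13 / 500) (13 / 1000) r A m := by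
  have e1 : (3 / 10 : ℝ) / 3 = 1 / 10 := by norm_num
  have h := su3_torusClusteringOnBallUpTo_pvStar 20 (βW := 3 / 10) (ε₀ := 13 / 500) (ε₁ := 13 / 1000)
    (c := 87731 / 1000000) (lam := 22517 / 1000000) (E := 1026341 / 1000000) (R := 1 / 5) (q := 1044031 / 1000000)
    (p := 912871 / 500000) (K := 122693 / 50000) (by norm_num) (by norm_num) (by norm_num) (by norm_num) (by norm_num) (by norm_num)
    (by norm_num) (by norm_num) (by norm_num) (by norm_num)
    (by refine (Real.exp_bound' (x := 13 / 500) (by norm_num) (by norm_num) (n := 5) (by norm_num)).trans ?_; simp only [Finset.sum_range_succ, Finset.sum_range_zero, Nat.factorial]; norm_num)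
    (by norm_num) (by norm_num) (by norm_num) (by unfold doorPoly; norm_num) (by unfold gaugeR Delta; norm_num) r
  rw [e1] at h
  exact h

/-- `SU(3)`, `d = 4`, HYPOTHESIS-FREE: row `(31 / 100, .005)` — torus clustering on the whole tier-1 ball for every `0 ≤ β ≤ 31 / 300`
(PV modulus at radius `31 / 150`, `K = 15659 / 6250`; certificate `c = 22169 / 250000`, `λ = 8661 / 1000000`, `E = 1010051 / 1000000`). [folklore] -/
theorem su3_torusClusteringOnBallUpTo_pvStar_thirtyOneHundredths (r : ℕ) :
    ∃ A m : ℝ, 0 < m ∧ TorusClusteringOnBallUpTo 3 4 (31 / 300) (1 / 100) (1 / 200) r A m := by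
  have e1 : (31 / 100 : ℝ) / 3 = 31 / 300 := by norm_num
  have h := su3_torusClusteringOnBallUpTo_pvStar 20 (βW := 31 / 100) (ε₀ := 1 / 100) (ε₁ := 1 / 200)
    (c := 22169 / 250000) (lam := 8661 / 1000000) (E := 1010051 / 1000000) (R := 31 / 150) (q := 261737 / 250000)
    (p := 1846373 / 1000000) (K := 15659 / 6250) (by norm_num) (by norm_num) (by norm_num) (by norm_num) (by norm_num) (by norm_num)
    (by norm_num) (by norm_num) (by norm_num) (by norm_num)
    (by refine (Real.exp_bound' (x := 1 / 100) (by norm_num) (by norm_num) (n := 5) (by norm_num)).trans ?_; simp only [Finset.sum_range_succ, Finset.sum_range_zero, Nat.factorial]; norm_num)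
    (by norm_num) (by norm_num) (by norm_num) (by unfold doorPoly; norm_num) (by unfold gaugeR Delta; norm_num) r
  rw [e1] at h
  exact h

/-- `SU(3)`, `d = 4`, HYPOTHESIS-FREE, READS-INCIDENCE ball: row `(1 / 4, .049)` at `β = 1 / 12` (same certificate). [folklore] -/
theorem su3_torusClusteringOnBallFine_pvStar_oneQuarter (r : ℕ) :
    ∃ A m : ℝ, 0 < m ∧ TorusClusteringOnBallFine 3 4 (1 / 12) (49 / 500) (49 / 1000) r A m := by
  have e1 : (1 / 4 : ℝ) / 3 = 1 / 12 := by norm_num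
  have h := su3_torusClusteringOnBallFine_pvStar 20 (βW := 1 / 4) (ε₀ := 49 / 500) (ε₁ := 49 / 1000)
    (c := 4969 / 62500) (lam := 84871 / 1000000) (E := 1102963 / 1000000) (R := 1 / 6) (q := 1030777 / 1000000)
    (p := 1732051 / 1000000) (K := 110919 / 50000) (by norm_num) (by norm_num) (by norm_num) (by norm_num) (by norm_num) (by norm_num)
    (by norm_num) (by norm_num) (by norm_num) (by norm_num)
    (by refine (Real.exp_bound' (x := 49 / 500) (by norm_num) (by norm_num) (n := 5) (by norm_num)).trans ?_; simp only [Finset.sum_range_succ, Finset.sum_range_zero, Nat.factorial]; norm_num)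
    (by norm_num) (by norm_num) (by norm_num) (by unfold doorPoly; norm_num) (by unfold gaugeR Delta; norm_num) r
  rw [e1] at h
  exact h

end Summit.Ventures.YMGap.RobustBall

end
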